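import Summits.PneNP.PneNP.Theorems.PermanentDescentPermanentNotInPLadderBase
import Summits.PneNP.PneNP.Theorems.PermanentDescentPermanentNotInPStubPermBitsPPP
import Literature.LinearAlgebra.Matrix.PermanentModTwoPowCorrect
import Literature.Computability.Complexity.PermanentModTwoPowFPStages
import Literature.Barriers.PneNP.FeasibleInterpolationProofs

/-!
# Route PermanentDescent, crux `PermanentNotInP` (stmt-PneNP-16143), line `Sketch` (xp-ladder) —
# EVERY rung of the precision ladder is in `P` (Valiant 1979, Thm. 3)

The line `Sketch` reads the crux `PermBits ∉ P` as the limit rung of the 2-adic precision ladder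
`PermLowBits k = {⟨s, bin i⟩ ∈ PermBits | i < k}`. Its transfer (stubs A, B, landed) shows that ONE
polynomial-time decider for `PermBits` would put every rung into a single `DTIME(n^c)`, so the crux
follows from the unboundedness of the fixed-precision exponents (stub C, open, ≥ crux = `P ≠ PP` by
`PermanentDescentPermanentNotInPCalibration.lean`). This file is the card's NECESSARY-USE CONSTRAINT
`ValiantLowBitsInP` in full — the registered side stub `stub_valiantRungs` of the skeleton:

* `permLowBits_mem_P k` / `stub_valiantRungs` : **for every `k`, `PermLowBits k ∈ P`**.

So the crux is FALSE at every finite precision: a proof of `PermanentNotInP` must use an ingredient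
that fails for each `perm mod 2^k`, and stub C's witnesses `k(c)` are genuinely unbounded.

Proof. Valiant 1979, Thm. 3 ("`perm A mod 2^k` in `O(n^{4k-3})` steps"), kernel-checked in three
layers of the Literature: the list program `PermMod2.pm` (`PermanentModTwoPowAlgorithm.lean`:
eliminate a column with an odd pivot, paying per row operation the correction
`2·Σ_{b<b'} q_b q_b' · perm(minor)` which needs the `(n-2)`-minors only modulo `2^(k-1)`; an all-even
column costs one factor `2` directly), its correctness `PermMod2.pm_rows : pm k (rows M) = perm M % 2^k`
(`PermanentModTwoPowSteps.lean`, `PermanentModTwoPowCorrect.lean`, via the two-equal-rows identity of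
`PermanentEqualRows.lean`), and its polynomial running time on codes
`PermMod2FP.pmFP : ∀ k, CodeFP (rawE (rawE natE)) natE (pm k)` (`PermanentModTwoPowFP.lean`,
`PermanentModTwoPowFPStages.lean`). Here the decider parses `x = ⟨s, t⟩` (`wfB`: `x` re-pairs to
itself and `|s|` is a perfect square), checks `⟦t⟧ < k`, builds the row list of the `√|s| × √|s|`
word matrix over `ℕ` (`rowsN_codeFP`, twin of `LadderBase.rowsZ_codeFP`), runs `pm k` and reads bit
`⟦t⟧` of the result off its binary numeral (`getD_encodeNat_eq_testBit`; bit `i < k` of `perm` is bit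
`i` of `perm % 2^k`, `Nat.testBit_mod_two_pow`). A language cut out by a `CodeFP` bit is in `P`
(`LFKN.setOf_codeFP_mem_P`).

Lead prover-line-stmt-PneNP-16143-c2-0 (continuation c2), `--supports stmt-PneNP-16143`.
-/

set_option linter.dupNamespace false -- `Summit.PneNP.PneNP.…`: summit = sub-problem name (D-0017 single-conjunct layout)

namespace Summit.PneNP.PneNP.Theorems.XpLadder

open _root_.Computability Literature.Computability.Complexity Literature.Computability.Complexity.Brick
  Literature.Computability.Complexity.CodeFP Summit.PneNP.PneNP.Theorems.PermCert
  Literature.LinearAlgebra.Matrix Literature.LinearAlgebra.Matrix.PermMod2 Literature.Computability.Complexity.PermMod2FP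

/-- **The natural-number word matrix as nested bounded loops**: the row list of the `m × m` 0/1 word
matrix of `s` over `ℕ` is the double `map` over `List.range m` of the entry function. [folklore] -/
theorem rows_wordMatrixN_eq (m : ℕ) (s : List Bool) :
    Berkowitz.rows (Matrix.of fun a b : Fin m => if s.getD ((b : ℕ) + m * (a : ℕ)) false then (1 : ℕ) else 0) =
      (List.range m).map fun a => (List.range m).map fun b => if s.getD (b + m * a) false then (1 : ℕ) else 0 := by
  rw [Berkowitz.rows]
  refine ofFn_eq_map_range _ _ fun a => ?_
  refine ofFn_eq_map_range _ _ fun b => ?_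
  simp [Matrix.of_apply]

/-- **One entry** `((⟨m, s⟩, a), b) ↦ s[b + m·a] ∈ {0, 1} ⊆ ℕ`. [cite: AroraBarak2009, §1.3] -/
theorem entryN_codeFP :
    CodeFP (pairE (pairE (pairE unE strE) natE) natE) natE
      (fun q => if q.1.1.2.getD (q.2 + q.1.1.1 * q.1.2) false then (1 : ℕ) else 0) := by
  have hs : CodeFP (pairE (pairE (pairE unE strE) natE) natE) strE (fun q => q.1.1.2) := ((fst _ _).fst').snd'
  have hm : CodeFP (pairE (pairE (pairE unE strE) natE) natE) natE (fun q => q.1.1.1) := (natOfUn.comp ((fst _ _).fst').fst' :)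
  have ha : CodeFP (pairE (pairE (pairE unE strE) natE) natE) natE (fun q => q.1.2) := (fst _ _).snd'
  have hb : CodeFP (pairE (pairE (pairE unE strE) natE) natE) natE (fun q => q.2) := snd _ _
  have hidx : CodeFP (pairE (pairE (pairE unE strE) natE) natE) natE (fun q => q.2 + q.1.1.1 * q.1.2) :=
    natAdd.comp (hb.pair (natMul.comp (hm.pair ha)))
  have hbit : CodeFP (pairE (pairE (pairE unE strE) natE) natE) bitE (fun q => q.1.1.2.getD (q.2 + q.1.1.1 * q.1.2) false) :=
    strGetDNat.comp (hs.pair hidx)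
  exact hbit.ite (const _ (1 : ℕ)) (const _ (0 : ℕ))

/-- **One row** `(⟨m, s⟩, a) ↦ [entry (a, b) | b < m]`. [cite: AroraBarak2009, §1.3] -/
theorem rowN_codeFP :
    CodeFP (pairE (pairE unE strE) natE) (rawE natE)
      (fun p => (List.range p.1.1).map fun b => if p.1.2.getD (b + p.1.1 * p.2) false then (1 : ℕ) else 0) := by
  have h := map (σ := (ℕ × List Bool) × ℕ) (eσ := pairE (pairE unE strE) natE) (eα := natE) entryN_codeFP
  have hr : CodeFP (pairE (pairE unE strE) natE) (pairE (pairE (pairE unE strE) natE) (rawE natE))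
      (fun p => (p, List.range p.1.1)) := (CodeFP.id _).pair (urange.comp (fst _ _).fst')
  exact (h.comp hr).congr fun _ => rfl

/-- **The whole row list** `⟨m, s⟩ ↦ rows`. [cite: AroraBarak2009, §1.3] -/
theorem rowsN_codeFP :
    CodeFP (pairE unE strE) (rawE (rawE natE))
      (fun σ => (List.range σ.1).map fun a => (List.range σ.1).map fun b =>
        if σ.2.getD (b + σ.1 * a) false then (1 : ℕ) else 0) := by
  have h := map (σ := ℕ × List Bool) (eσ := pairE unE strE) (eα := natE) rowN_codeFP
  have hr : CodeFP (pairE unE strE) (pairE (pairE unE strE) (rawE natE)) (fun σ => (σ, List.range σ.1)) :=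
    (CodeFP.id _).pair (urange.comp (fst _ _))
  exact (h.comp hr).congr fun _ => rfl

/-- **The decider of rung `k` is polynomial time on codes**: parse, test well-formedness (`wfB`) and
`i < k`, run Valiant's `pm k` on the `√|s| × √|s|` word matrix (`pmFP k`) and read bit `i` of the
result off its binary numeral. [cite: Valiant1979, Thm. 3] [cite: AroraBarak2009, §1.3] -/
theorem rungDecider_codeFP (k : ℕ) :
    CodeFP strE bitE (fun x => wfB x && (decide (bitsToNat (sndF x) < k) &&
      (encodeNat (pm k ((List.range (Nat.sqrt (fstF x).length)).map fun a =>
        (List.range (Nat.sqrt (fstF x).length)).map fun b =>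
          if (fstF x).getD (b + Nat.sqrt (fstF x).length * a) false then (1 : ℕ) else 0))).getD
            (bitsToNat (sndF x)) false)) := by
  have hs : CodeFP strE strE fstF := of_fn fstF fstF_mem_FP fun _ => rfl
  have ht : CodeFP strE strE sndF := of_fn sndF sndF_mem_FP fun _ => rfl
  have hi : CodeFP strE natE (fun x => bitsToNat (sndF x)) := strVal.comp ht
  have hlenU : CodeFP strE unE (fun x => (fstF x).length) := strLength.comp hs
  have hlen : CodeFP strE natE (fun x => (fstF x).length) := (natOfUn.comp hlenU :)
  have hk : CodeFP strE bitE (fun x => decide (bitsToNat (sndF x) < k)) := natLt.comp (hi.pair (const _ k))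
  have hmU : CodeFP strE unE (fun x => Nat.sqrt (fstF x).length) :=
    (unOfNatMin.comp (hlenU.pair (natSqrt.comp hlen))).congr fun x => min_eq_left (Nat.sqrt_le_self _)
  have hrows : CodeFP strE (rawE (rawE natE)) (fun x =>
      (List.range (Nat.sqrt (fstF x).length)).map fun a =>
        (List.range (Nat.sqrt (fstF x).length)).map fun b =>
          if (fstF x).getD (b + Nat.sqrt (fstF x).length * a) false then (1 : ℕ) else 0) :=
    (rowsN_codeFP.comp (hmU.pair hs)).congr fun _ => rfl
  have hpm := (pmFP k).comp hrows
  have hcode : CodeFP strE strE (fun x => encodeNat (pm k ((List.range (Nat.sqrt (fstF x).length)).map fun a =>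
      (List.range (Nat.sqrt (fstF x).length)).map fun b =>
        if (fstF x).getD (b + Nat.sqrt (fstF x).length * a) false then (1 : ℕ) else 0))) :=
    (transparent (eα := natE) (eβ := strE) (g := fun n : ℕ => encodeNat n) fun _ => rfl).comp hpm
  have hbit := strGetDNat.comp (hcode.pair hi)
  exact wfB_codeFP.and (hk.and hbit)

/-- **Valiant reads the rung**: for a word matrix of side `m`, bit `i < k` of the permanent is bit `i`
of `pm k` of the row list. [cite: Valiant1979, Thm. 3] -/
theorem getD_encodeNat_pm_rows (k m : ℕ) (s : List Bool) {i : ℕ} (hi : i < k) :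
    (encodeNat (pm k ((List.range m).map fun a => (List.range m).map fun b =>
        if s.getD (b + m * a) false then (1 : ℕ) else 0))).getD i false =
      (permWord m s).testBit i := by
  rw [Literature.Barriers.PneNP.TripleDecoder.getD_encodeNat_eq_testBit, ← rows_wordMatrixN_eq, pm_rows,
    Nat.testBit_mod_two_pow, decide_eq_true hi, Bool.true_and]
  rfl

/-- **EVERY rung of the precision ladder is in `P`: `PermLowBits k ∈ P`** (the words `⟨s, bin i⟩` with
`i < k`, `|s| = n²` and bit `i` of `perm_ℕ(M_s)` set — the crux's set-builder with the guard `i < k`).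
[cite: Valiant1979, Thm. 3] -/
theorem permLowBits_mem_P (k : ℕ) :
    ({w | ∃ (n : ℕ) (s : List Bool) (i : ℕ), i < k ∧ s.length = n * n ∧
        w = Literature.Computability.Complexity.boolPair s (Computability.encodeNat i) ∧
        Nat.testBit (Matrix.permanent (Matrix.of fun a b : Fin n =>
          if s.getD ((b : ℕ) + n * (a : ℕ)) false then (1 : ℕ) else 0)) i = true} : Language Bool) ∈
      Literature.Computability.Complexity.Classes.P := by
  have hP := LFKN.setOf_codeFP_mem_P (rungDecider_codeFP k)
  convert hP using 1
  ext x
  constructor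
  · rintro ⟨n, s, i, hik, hs, rfl, hbit⟩
    have hsq : Nat.sqrt (n * n) = n := Nat.sqrt_eq n
    show (wfB _ && _) = true
    simp only [wfB, fstF_boolPair, sndF_boolPair, bitsToNat_encodeNat, hs, hsq, and_self, decide_true,
      Bool.true_and, hik]
    rw [getD_encodeNat_pm_rows k n s hik]
    exact hbit
  · intro hx
    change (wfB x && _) = true at hx
    simp only [Bool.and_eq_true, wfB, decide_eq_true_eq] at hx
    obtain ⟨⟨hpair, hsq⟩, hik, hbit⟩ := hx
    refine ⟨Nat.sqrt (fstF x).length, fstF x, bitsToNat (sndF x), hik, hsq.symm, hpair.symm, ?_⟩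
    change (permWord _ _).testBit _ = true
    rw [← getD_encodeNat_pm_rows k _ _ hik]
    exact hbit

/-- **Registered stub `stub_valiantRungs` of the line `Sketch`** (crux stmt-PneNP-16143): every rung of
the 2-adic precision ladder is in `P` — Valiant 1979, Thm. 3, kernel-checked from the list program
`PermMod2.pm`, its correctness `pm_rows` and its polynomial running time `pmFP`. [cite: Valiant1979, Thm. 3] -/
theorem stub_valiantRungs :
    ∀ k : ℕ,
      ({w | ∃ (n : ℕ) (s : List Bool) (i : ℕ), i < k ∧ s.length = n * n ∧ w = Literature.Computability.Complexity.boolPair s (Computability.encodeNat i) ∧ Nat.testBit (Matrix.permanent (Matrix.of fun a b : Fin n => if s.getD ((b : ℕ) + n * (a : ℕ)) false then (1 : ℕ) else 0)) i = true} : Language Bool)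
        ∈ Literature.Computability.Complexity.Classes.P :=
  permLowBits_mem_P

end Summit.PneNP.PneNP.Theorems.XpLadder
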